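import Literature.Computability.Cryptography.CubicClassTablePeriodic
import Literature.Computability.Cryptography.CubicClassTableSpecs
import Mathlib.Data.Nat.Bitwise
import Mathlib.Data.Fintype.BigOperators
import HarnessLib

/-!
# The class-group table and its coins: swapping the cube-root program, counting bad coin blocks

Topic `Computability/Cryptography`; theorem-only companion of `CubicClassTable.lean` / `CubicClassTableLadder.lean` (crux
`LinnikCubicClassGroups.PureCubicClassGroupFBQP`, line `arakelov-giant-step-cycle`). Clause (ii) of the structural interface
of the ladder class table ("off a small set of coin values the table ignores the coins"):

* `WalkFns.classTableOpQ_congr_gens` — two program bundles with the same `primeL`, `latProd`, `redL` produce the same table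
  value at positions with the same generator list, exponent block and grid index (the table reads the coins ONLY through
  `gens`); in particular the table with the TRUE cube roots in place of the coin-driven program is a coin-free table that
  agrees with the real one wherever the coins give the true roots;
* `card_block_filter_le` — for a property of the `i`-th block of `ℓb` coins, the number of coin values `κ < 2^ℓκ` having it
  is at most (number of blocks having it) `· 2^(ℓκ − ℓb)` (split `κ` into low part, block, high part);
* `card_filter_vector_eq_uniformProb` — the block count is `uniformProb ℓb · 2^ℓb`;
* `card_badCoins_le` — **the bad coin values are few**: if each prime's root program fails on at most a `2^-s'` fraction of
  its blocks (`RootsSem`), at most `|ps| · 2^-s' · 2^ℓκ` coin values make some prime's root list wrong.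
[Hallgren 2005, §4]

## References

* S. Hallgren, STOC 2005, §4. [Hallgren2005]
-/

namespace Literature.Computability.Cryptography

namespace CubicClassTable

open Literature.Computability.Complexity (uniformProb)

namespace WalkFns

section Congr

variable {F F' : WalkFns} {I : Inst}

/-- Bundles with the same `redL` have the same clamped reduction. [folklore] -/
theorem redc_congr (h : F.redL = F'.redL) (cap : ℕ) : F.redc I cap = F'.redc I cap := by
  funext c; unfold redc red; rw [h]

/-- … and the same clamped product-and-reduce. [folklore] -/
theorem starCc_congr (hp : F.latProd = F'.latProd) (h : F.redL = F'.redL) (cap : ℕ) : F.starCc I cap = F'.starCc I cap := by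
  funext p q; unfold starCc; rw [hp, redc_congr h]

/-- … the same clamped square-and-multiply. [folklore] -/
theorem powCc_congr (hp : F.latProd = F'.latProd) (h : F.redL = F'.redL) (cap : ℕ) : F.powCc I cap = F'.powCc I cap := by
  funext g n; unfold powCc; rw [starCc_congr hp h]

/-- … the same ladder. [folklore] -/
theorem ladder_congr (hp : F.latProd = F'.latProd) (h : F.redL = F'.redL) (cap : ℕ) : F.ladder I cap = F'.ladder I cap := by
  funext i; unfold ladder hbase stepc; rw [starCc_congr hp h, redc_congr h]

/-- … the same descent. [folklore] -/
theorem descend_congr (hp : F.latProd = F'.latProd) (h : F.redL = F'.redL) (cap : ℕ) : F.descend I cap = F'.descend I cap := by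
  funext X st; unfold descend tryMul; rw [ladder_congr hp h, starCc_congr hp h]

/-- **`b_E` depends on the coins only through the generator slots.** [folklore] -/
theorem bEc_congr_gens (hp : F.latProd = F'.latProd) (h : F.redL = F'.redL) (cap : ℕ) {v v' : ℕ}
    (hg : ∀ t, F.gT I v t = F'.gT I v' t) (hE : I.Eof v = I.Eof v') : F.bEc I cap v = F'.bEc I cap v' := by
  unfold bEc; simp_rw [hg, Inst.digit_congr I hE, powCc_congr hp h, redc_congr h, starCc_congr hp h]

/-- **The table depends on the coins only through the generator slots** (and otherwise on `Eof v`, `jof v`).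
[cite: Hallgren2005, §4] -/
theorem classTableOpQ_congr_gens (hp : F.latProd = F'.latProd) (h : F.redL = F'.redL) (cap : ℕ) {v v' : ℕ}
    (hg : ∀ t, F.gT I v t = F'.gT I v' t) (hE : I.Eof v = I.Eof v') (hj : I.jof v = I.jof v') :
    F.classTableOpQ I cap v = F'.classTableOpQ I cap v' := by
  have hb : F.bEc I cap v = F'.bEc I cap v' := bEc_congr_gens hp h cap hg hE
  have ht : F.tstarc I cap v = F'.tstarc I cap v' := by unfold tstarc Δc; rw [hb, Inst.tgt_congr I hj]
  have hc0 : F.c0q I cap v = F'.c0q I cap v' := by unfold c0q; rw [descend_congr hp h, ht, hb]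
  have hbs : F.babyStepc I cap v = F'.babyStepc I cap v' := by
    funext st; unfold babyStepc; rw [redc_congr h, ht]
  have hfin : F.cfinq I cap v = F'.cfinq I cap v' := by unfold cfinq; rw [hbs, hc0]
  unfold classTableOpQ; rw [hfin, ht]

/-- The generator list depends on the root program only through its values on the instance's primes and coins. [folklore] -/
theorem gens_congr_roots (hpl : F.primeL = F'.primeL) {v v' : ℕ}
    (hr : ∀ i < I.ps.length, F.roots (I.ps.getD i 0, I.m, I.coins v i) = F'.roots (I.ps.getD i 0, I.m, I.coins v' i)) :
    F.gens I v = F'.gens I v' := by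
  unfold gens
  rw [hpl]
  apply List.flatMap_congr
  intro i hi
  rw [List.mem_range] at hi
  rw [hr i hi]

/-- … hence so do the generator slots. [folklore] -/
theorem gT_congr_roots (hpl : F.primeL = F'.primeL) {v v' : ℕ}
    (hr : ∀ i < I.ps.length, F.roots (I.ps.getD i 0, I.m, I.coins v i) = F'.roots (I.ps.getD i 0, I.m, I.coins v' i)) (t : ℕ) :
    F.gT I v t = F'.gT I v' t := by
  unfold gT; rw [gens_congr_roots hpl hr]

end Congr

end WalkFns

/-! ### Counting coin values by blocks -/

section Blocks

open Finset

/-- **Counting by the `i`-th block.** For `(i + 1) ℓb ≤ ℓκ` and any property `P` of lists, the number of `κ < 2^ℓκ` whose `i`-th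
block of `ℓb` bits has `P` is at most the number of blocks having `P` times `2^(ℓκ − ℓb)`. [folklore] -/
theorem card_block_filter_le (ℓκ ℓb i : ℕ) (hi : (i + 1) * ℓb ≤ ℓκ) (P : List Bool → Prop) [DecidablePred P]
    [DecidablePred fun w : List.Vector Bool ℓb => P w.toList] :
    ((Finset.range (2 ^ ℓκ)).filter (fun κ => P (List.ofFn fun q : Fin ℓb => Nat.testBit κ (i * ℓb + q)))).card ≤
      ((Finset.univ : Finset (List.Vector Bool ℓb)).filter (fun w => P w.toList)).card * 2 ^ (ℓκ - ℓb) := by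
  set lo : ℕ := i * ℓb with hlo
  have hi' : lo + ℓb ≤ ℓκ := by rw [hlo]; rw [Nat.succ_mul] at hi; exact hi
  set hiw : ℕ := ℓκ - lo - ℓb with hhiw
  have hsplit : ℓκ = hiw + (lo + ℓb) := by omega
  set vec : ℕ → List.Vector Bool ℓb := fun κ => ⟨List.ofFn fun q : Fin ℓb => Nat.testBit κ (lo + q), List.length_ofFn⟩
    with hvec
  set f : ℕ → List.Vector Bool ℓb × (ℕ × ℕ) := fun κ => (vec κ, (κ % 2 ^ lo, κ / 2 ^ (lo + ℓb))) with hf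
  set Src : Finset ℕ := (Finset.range (2 ^ ℓκ)).filter
    (fun κ => P (List.ofFn fun q : Fin ℓb => Nat.testBit κ (i * ℓb + q))) with hSrc
  set Tgt : Finset (List.Vector Bool ℓb × (ℕ × ℕ)) :=
    ((Finset.univ : Finset (List.Vector Bool ℓb)).filter (fun w => P w.toList)) ×ˢ
      (Finset.range (2 ^ lo) ×ˢ Finset.range (2 ^ hiw)) with hTgt
  have hmaps : Set.MapsTo f (Src : Set ℕ) (Tgt : Set (List.Vector Bool ℓb × (ℕ × ℕ))) := by
    intro κ hκ
    rw [Finset.mem_coe, hSrc, Finset.mem_filter, Finset.mem_range] at hκ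
    rw [Finset.mem_coe, hTgt, Finset.mem_product, Finset.mem_product, Finset.mem_filter, Finset.mem_range,
      Finset.mem_range]
    refine ⟨⟨Finset.mem_univ _, by simpa [hf, hvec, hlo] using hκ.2⟩, Nat.mod_lt _ (by positivity), ?_⟩
    rw [Nat.div_lt_iff_lt_mul (by positivity), ← pow_add, ← hsplit]
    exact hκ.1
  have hinj : Set.InjOn f (Src : Set ℕ) := by
    intro κ _ κ' _ hκκ
    simp only [hf, Prod.mk.injEq] at hκκ
    obtain ⟨hblock, hlo', hhi'⟩ := hκκ
    have hblock' : (fun q : Fin ℓb => Nat.testBit κ (lo + q)) = fun q : Fin ℓb => Nat.testBit κ' (lo + q) := by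
      have h := congrArg List.Vector.toList hblock
      simpa [hvec] using h
    apply Nat.eq_of_testBit_eq
    intro n
    rcases lt_or_ge n lo with hn | hn
    · have h1 := congrArg (fun x => Nat.testBit x n) hlo'
      simpa [Nat.testBit_mod_two_pow, hn] using h1
    · rcases lt_or_ge n (lo + ℓb) with hn2 | hn2
      · obtain ⟨q, hq⟩ : ∃ q : ℕ, n = lo + q := ⟨n - lo, by omega⟩
        have hqℓ : q < ℓb := by omega
        have h1 := congrFun hblock' (⟨q, hqℓ⟩ : Fin ℓb)
        rw [hq]; simpa using h1
      · obtain ⟨q, hq⟩ : ∃ q : ℕ, n = q + (lo + ℓb) := ⟨n - (lo + ℓb), by omega⟩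
        have h1 := congrArg (fun x => Nat.testBit x q) hhi'
        simp only [Nat.testBit_div_two_pow] at h1
        rw [hq]; exact h1
  calc Src.card ≤ Tgt.card := Finset.card_le_card_of_injOn f hmaps hinj
    _ = ((Finset.univ : Finset (List.Vector Bool ℓb)).filter (fun w => P w.toList)).card * 2 ^ (ℓκ - ℓb) := by
        rw [hTgt, Finset.card_product, Finset.card_product, Finset.card_range, Finset.card_range, ← pow_add]
        congr 2; omega

open scoped Classical in
/-- The block count is `uniformProb ℓb · 2^ℓb`. [folklore] -/
theorem card_filter_vector_eq_uniformProb (ℓb : ℕ) (E : Set (List Bool)) :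
    (((Finset.univ : Finset (List.Vector Bool ℓb)).filter (fun w => w.toList ∈ E)).card : ℝ) = uniformProb ℓb E * 2 ^ ℓb := by
  unfold uniformProb
  rw [div_mul_cancel₀ _ (by positivity)]

open scoped Classical in
/-- **The bad coin values are few.** If for every `i < |ps|` the root program is wrong on at most a `2^-s'` fraction of the
blocks of `ℓb` coins, then at most `|ps| · 2^-s' · 2^ℓκ` values `κ < 2^ℓκ` (`|ps| ℓb ≤ ℓκ`) make some prime's root list wrong.
[cite: Hallgren2005, §4] -/
theorem card_badCoins_le (roots : ℕ × ℕ × List Bool → List ℕ) (good : ℕ → List ℕ) (ps : List ℕ) (m ℓκ ℓb s' : ℕ)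
    (hℓ : ps.length * ℓb ≤ ℓκ)
    (hroots : ∀ i < ps.length, uniformProb ℓb {κ | roots (ps.getD i 0, m, κ) ≠ good (ps.getD i 0)} ≤ (1 / 2) ^ s') :
    ((((Finset.range (2 ^ ℓκ)).filter (fun κ => ∃ i < ps.length,
        roots (ps.getD i 0, m, List.ofFn fun q : Fin ℓb => Nat.testBit κ (i * ℓb + q)) ≠ good (ps.getD i 0))).card : ℕ) : ℝ) ≤
      ps.length * (1 / 2) ^ s' * 2 ^ ℓκ := by
  set B : ℕ → Finset ℕ := fun i => (Finset.range (2 ^ ℓκ)).filter (fun κ =>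
      roots (ps.getD i 0, m, List.ofFn fun q : Fin ℓb => Nat.testBit κ (i * ℓb + q)) ≠ good (ps.getD i 0)) with hB
  have hsub : (Finset.range (2 ^ ℓκ)).filter (fun κ => ∃ i < ps.length,
      roots (ps.getD i 0, m, List.ofFn fun q : Fin ℓb => Nat.testBit κ (i * ℓb + q)) ≠ good (ps.getD i 0)) ⊆
      (Finset.range ps.length).biUnion B := by
    intro κ hκ
    rw [Finset.mem_filter] at hκ
    obtain ⟨hκ, i, hi, hbad⟩ := hκ
    exact Finset.mem_biUnion.mpr ⟨i, Finset.mem_range.mpr hi, Finset.mem_filter.mpr ⟨hκ, hbad⟩⟩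
  have hBi : ∀ i < ps.length, ((B i).card : ℝ) ≤ (1 / 2) ^ s' * 2 ^ ℓκ := by
    intro i hi
    have hblk : (i + 1) * ℓb ≤ ℓκ := le_trans (Nat.mul_le_mul_right _ (by omega)) hℓ
    have h1 := card_block_filter_le ℓκ ℓb i hblk (fun l => roots (ps.getD i 0, m, l) ≠ good (ps.getD i 0))
    have h2 := card_filter_vector_eq_uniformProb ℓb {κ | roots (ps.getD i 0, m, κ) ≠ good (ps.getD i 0)}
    simp only [Set.mem_setOf_eq] at h2
    have h1' : ((B i).card : ℝ) ≤ (((Finset.univ : Finset (List.Vector Bool ℓb)).filter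
        (fun w => roots (ps.getD i 0, m, w.toList) ≠ good (ps.getD i 0))).card : ℝ) * 2 ^ (ℓκ - ℓb) := by
      rw [hB]; exact_mod_cast h1
    rw [h2] at h1'
    have hℓb : ℓb ≤ ℓκ := le_trans (by nlinarith [show 1 ≤ ps.length by omega]) hℓ
    have hpow : (2 : ℝ) ^ ℓb * 2 ^ (ℓκ - ℓb) = 2 ^ ℓκ := by rw [← pow_add]; congr 1; omega
    calc ((B i).card : ℝ) ≤ uniformProb ℓb {κ | roots (ps.getD i 0, m, κ) ≠ good (ps.getD i 0)} * 2 ^ ℓb * 2 ^ (ℓκ - ℓb) := h1'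
      _ ≤ (1 / 2) ^ s' * 2 ^ ℓb * 2 ^ (ℓκ - ℓb) := by gcongr; exact hroots i hi
      _ = (1 / 2) ^ s' * 2 ^ ℓκ := by rw [mul_assoc, hpow]
  calc ((((Finset.range (2 ^ ℓκ)).filter (fun κ => ∃ i < ps.length,
        roots (ps.getD i 0, m, List.ofFn fun q : Fin ℓb => Nat.testBit κ (i * ℓb + q)) ≠ good (ps.getD i 0))).card : ℕ) : ℝ)
      ≤ (((Finset.range ps.length).biUnion B).card : ℝ) := by exact_mod_cast Finset.card_le_card hsub
    _ ≤ ∑ i ∈ Finset.range ps.length, ((B i).card : ℝ) := by exact_mod_cast Finset.card_biUnion_le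
    _ ≤ ∑ i ∈ Finset.range ps.length, (1 / 2 : ℝ) ^ s' * 2 ^ ℓκ :=
        Finset.sum_le_sum fun i hi => hBi i (Finset.mem_range.mp hi)
    _ = ps.length * (1 / 2) ^ s' * 2 ^ ℓκ := by rw [Finset.sum_const, Finset.card_range]; simp; ring

end Blocks


section Summary

open scoped Classical in
/-- **Summary (registered helper of the class-group stage)**: the coin values that make some prime's cube-root list wrong
are few. [cite: Hallgren2005, §4] -/
theorem cubicClassTable_card_badCoins_le : ∀ (roots : ℕ × ℕ × List Bool → List ℕ) (good : ℕ → List ℕ) (ps : List ℕ) (m ℓκ ℓb s' : ℕ), ps.length * ℓb ≤ ℓκ → (∀ i < ps.length, Literature.Computability.Complexity.uniformProb ℓb {κ | roots (ps.getD i 0, m, κ) ≠ good (ps.getD i 0)} ≤ (1 / 2) ^ s') → ((((Finset.range (2 ^ ℓκ)).filter (fun κ => ∃ i < ps.length, roots (ps.getD i 0, m, List.ofFn fun q : Fin ℓb => Nat.testBit κ (i * ℓb + q)) ≠ good (ps.getD i 0))).card : ℕ) : ℝ) ≤ ps.length * (1 / 2) ^ s' * 2 ^ ℓκ :=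
  fun roots good ps m ℓκ ℓb s' hℓ hroots => card_badCoins_le roots good ps m ℓκ ℓb s' hℓ hroots

end Summary

end CubicClassTable

end Literature.Computability.Cryptography
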